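import Literature.NumberTheory.PAdicHodge.DeRhamEllipticGoodOrdinaryAbove
import Literature.NumberTheory.PAdicHodge.DeRhamEllipticIsogeny
import Literature.NumberTheory.EllipticCurves.IsogenyVariableChangeProofs
import HarnessLib

/-!
# Potentially de Rham is de Rham: `V_pW|_{Γ_{K_v}}` is de Rham as soon as some `K'`-model of `W ×_K K'` is de Rham at a
# place `v' ∣ v` of a finite extension `K'/K` (proofs only)

Topic `NumberTheory/PAdicHodge`; namespace `Literature.NumberTheory.PAdicHodge`. THEOREMS ONLY (no definition, no named fact, no
instance, no `sorry`).

The DESCENT half of the potentially-good sector of hDR, abstracted from the ordinary file `DeRhamEllipticGoodOrdinaryAbove` (whose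
steps (2a) base change, (2b) towers, (3) Brinon–Conrad descent are repeated here with the per-curve de Rham theorem replaced by a
HYPOTHESIS), plus isogeny/isomorphism invariance (`DeRhamEllipticIsogeny`, `isIsogenous_smul`):

* `isDeRham_restrictedRationalTateRep_of_isDeRham_baseChange_above` — `W/K`, `v ∣ p`, `K'/K` finite, `v' ∣ v`: if
  `V_p(W ×_K K')|_{Γ_{K'_{v'}}}` is de Rham (for the canonical `p`-adic structures on `K'_{v'}`), then `V_pW|_{Γ_{K_v}}` is de Rham;
* `isDeRham_restrictedRationalTateRep_of_isDeRham_isogenous_above` — the same with `W ×_K K'` replaced by any `K'`-ISOGENOUS curve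
  `W₀/K'` (`IsIsogenous (W.baseChange K') W₀`);
* `isDeRham_restrictedRationalTateRep_of_isDeRham_smul_baseChange_above` — the same with the `K'`-isomorphic model `C • (W ×_K K')`,
  `C` an admissible change of variables over `K'` (the shape in which a GOOD MODEL over `𝒪_{K'_{v'}}` is presented: rescaling by a
  uniformizer power is defined over `K'`, not over `K`);
* `…_rat_…` specialisations at `K = ℚ`, `v` the place above `p` (the binder shape of the BSD files: `(p : 𝓞 ℚ) ∈ v.asIdeal`).

Motivation (BSD route EdixhovenFibreFiveSeven, crux K★ `stmt-BirchSwinnertonDyer-22226`, line `kato-lever`, stub hDR on the three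
potentially SUPERSINGULAR starred cells): there `W/ℚ` has additive reduction at `p ∈ {5, 7}` and acquires good supersingular reduction
over `K' = ℚ(p^{1/e})`, `e ∈ {3, 4, 6}`, through the rescaled model `C • (W ×_ℚ K')`, `C = (p^{k/e}, r, s, t)`; the de Rham-ness of
that model at `K'_{v'}` is the (ramified-coefficient) period computation, and this file turns it into the hDR binder at `ℚ_v`. BSD is
not proved by any of this; hDR stays cite-only.

## References
* [BrinonConrad2009] O. Brinon, B. Conrad, *CMI notes on p-adic Hodge theory* (2009), Prop. 6.3.8 (de Rham descent/ascent).
* [FontaineAsterisque223III] J.-M. Fontaine, Astérisque 223 (1994), Exp. III §1.5 (admissibility is isomorphism-invariant).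
* [SilvermanAEC2009] J. H. Silverman, *AEC* (2009), III.3.1(b), III.7, VII.5.
-/

noncomputable section

open Field ValuativeRel NumberField IsDedekindDomain

namespace Literature.NumberTheory.PAdicHodge

open Literature.NumberTheory.GaloisRepresentations
open Literature.NumberTheory.GaloisRepresentations.IsNonarchimedeanLocalField
open Literature.NumberTheory.EllipticCurves WeierstrassCurve
open Literature.NumberTheory.Automorphic

/-- **Potentially de Rham ⇒ de Rham (base change form).** `W/K` elliptic over a number field, `v ∣ p` a place of `K`, `K'/K` a
finite extension with a place `v' ∣ v`; if `V_p(W ×_K K')|_{Γ_{K'_{v'}}}` is de Rham for `B_dR(K'_{v'})` (hypothesis `h1`, for the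
canonical `p`-adic structures on `K'_{v'}`), then `V_pW|_{Γ_{K_v}}` is de Rham for `B_dR(K_v)`.
[cite: BrinonConrad2009, Prop. 6.3.8] [cite: FontaineAsterisque223III, Exp. III §1.5] -/
theorem isDeRham_restrictedRationalTateRep_of_isDeRham_baseChange_above
    {K : Type} [Field K] [NumberField K] (W : WeierstrassCurve K) [W.IsElliptic] {p : ℕ} [Fact p.Prime]
    {K' : Type} [Field K'] [NumberField K'] [Algebra K K']
    (v : HeightOneSpectrum (𝓞 K)) (v' : HeightOneSpectrum (𝓞 K')) [v'.asIdeal.LiesOver v.asIdeal]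
    (hv' : (p : 𝓞 K') ∈ v'.asIdeal)
    (h1 : ∀ [CharZero (v'.adicCompletion K')] [Fact (¬ IsUnit (p : integerC (v'.adicCompletion K')))]
      [IsAdicComplete (Ideal.span {(p : integerC (v'.adicCompletion K'))}) (integerC (v'.adicCompletion K'))]
      (hp' : valuation (v'.adicCompletion K') p < 1) [Algebra ℚ_[p] (v'.adicCompletion K')],
      GaloisRep.IsDeRham (bdRPeriodRingData (F := v'.adicCompletion K') (p := p) hp')
        (restrictedRationalTateRep (W.baseChange K') (v'.adicCompletion K') p))
    [CharZero (v.adicCompletion K)] [Fact (¬ IsUnit (p : integerC (v.adicCompletion K)))]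
    [IsAdicComplete (Ideal.span {(p : integerC (v.adicCompletion K))}) (integerC (v.adicCompletion K))]
    (hp : valuation (v.adicCompletion K) p < 1) [Algebra ℚ_[p] (v.adicCompletion K)] :
    GaloisRep.IsDeRham (bdRPeriodRingData (F := v.adicCompletion K) (p := p) hp)
      (restrictedRationalTateRep W (v.adicCompletion K) p) := by
  -- the `p`-adic field `F = K'_{v'}` and its structures
  have hp' : valuation (v'.adicCompletion K') (p : v'.adicCompletion K') < 1 :=
    LocalField.valuation_adicCompletion_natCast_lt_one v' p hv'
  haveI : CharZero (v'.adicCompletion K') := LocalField.charZero_adicCompletion v'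
  haveI : Fact (¬ IsUnit ((p : ℕ) : integerC (v'.adicCompletion K'))) := ⟨not_isUnit_natCast_integerC hp'⟩
  haveI : IsAdicComplete (Ideal.span {((p : ℕ) : integerC (v'.adicCompletion K'))}) (integerC (v'.adicCompletion K')) :=
    isAdicComplete_integerC_natCast hp'
  letI : Algebra ℚ_[p] (v'.adicCompletion K') := LocalField.padicAlgebra (v'.adicCompletion K') p hp'
  letI : Algebra (v.adicCompletion K) (v'.adicCompletion K') := (adicCompletionOfLiesOver K K' v v').toAlgebra
  haveI : IsScalarTower K (v.adicCompletion K) (v'.adicCompletion K') := isScalarTower_adicCompletionOfLiesOver v v'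
  haveI : Module.Finite ℚ_[p] (W.rationalTateModule p) := W.finite_rationalTateModule p
  set 𝔅 := bdRPeriodRingData (F := v'.adicCompletion K') (p := p) hp' with h𝔅
  set ρ := W.rationalTateGaloisRep p (W.continuous_rationalGaloisRepTate_holds p) with hρ
  -- (1) the hypothesis for `W ×_K K'` at `v'`
  have h1' : GaloisRep.IsDeRham 𝔅 (restrictedRationalTateRep (W.baseChange K') (v'.adicCompletion K') p) := h1 hp'
  -- (2a) base change `V_p(W_{K'})|_{Γ_{K'_{v'}}} ≅ (V_pW|_{Γ_{K'}})|_{Γ_{K'_{v'}}}`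
  have h2 : 𝔅.IsAdmissible ((ρ.restrictField K').restrictField (v'.adicCompletion K')) := by
    refine (𝔅.isAdmissible_iff_of_equiv ((ρ.restrictField K').restrictField (v'.adicCompletion K'))
      (restrictedRationalTateRep (W.baseChange K') (v'.adicCompletion K') p)
      (rationalTateModuleEquiv W K' p) fun σ x => ?_).2 h1'
    exact rationalTateModuleEquiv_rationalGaloisRepTate W K' p (absGaloisRestrict K' (v'.adicCompletion K') σ) x
  -- (2b) towers: `K ⊆ K' ⊆ K'_{v'}` and `K ⊆ K_v ⊆ K'_{v'}`
  have h3 : 𝔅.IsAdmissible (ρ.restrictField (v'.adicCompletion K')) :=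
    (GaloisRep.isAdmissible_restrictField_restrictField_iff (K₀ := K) (F₀ := K') 𝔅 ρ).1 h2
  have h4 : 𝔅.IsAdmissible ((ρ.restrictField (v.adicCompletion K)).restrictField (v'.adicCompletion K')) :=
    (GaloisRep.isAdmissible_restrictField_restrictField_iff (K₀ := K) (F₀ := v.adicCompletion K) 𝔅 ρ).2 h3
  -- (3) descent along `K_v → K'_{v'}`
  exact isDeRham_of_isDeRham_restrictField (K := v.adicCompletion K) (L := v'.adicCompletion K')
    (continuous_adicCompletionOfLiesOver K K' v v') hp hp' (restrictedRationalTateRep W (v.adicCompletion K) p) h4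

/-- **Potentially de Rham ⇒ de Rham (isogenous-model form).** As `isDeRham_restrictedRationalTateRep_of_isDeRham_baseChange_above`,
with the de Rham hypothesis placed on any curve `W₀/K'` ISOGENOUS over `K'` to `W ×_K K'` (an isogeny induces a `Γ_{K'}`-equivariant
isomorphism of rational Tate modules, `isDeRham_restrictedRationalTateRep_iff_of_isIsogenous`).
[cite: BrinonConrad2009, Prop. 6.3.8] [cite: SilvermanAEC2009, III.7.4] -/
theorem isDeRham_restrictedRationalTateRep_of_isDeRham_isogenous_above
    {K : Type} [Field K] [NumberField K] (W : WeierstrassCurve K) [W.IsElliptic] {p : ℕ} [Fact p.Prime]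
    {K' : Type} [Field K'] [NumberField K'] [Algebra K K']
    (v : HeightOneSpectrum (𝓞 K)) (v' : HeightOneSpectrum (𝓞 K')) [v'.asIdeal.LiesOver v.asIdeal]
    (hv' : (p : 𝓞 K') ∈ v'.asIdeal) (W₀ : WeierstrassCurve K') [W₀.IsElliptic] (hiso : IsIsogenous (W.baseChange K') W₀)
    (h1 : ∀ [CharZero (v'.adicCompletion K')] [Fact (¬ IsUnit (p : integerC (v'.adicCompletion K')))]
      [IsAdicComplete (Ideal.span {(p : integerC (v'.adicCompletion K'))}) (integerC (v'.adicCompletion K'))]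
      (hp' : valuation (v'.adicCompletion K') p < 1) [Algebra ℚ_[p] (v'.adicCompletion K')],
      GaloisRep.IsDeRham (bdRPeriodRingData (F := v'.adicCompletion K') (p := p) hp')
        (restrictedRationalTateRep W₀ (v'.adicCompletion K') p))
    [CharZero (v.adicCompletion K)] [Fact (¬ IsUnit (p : integerC (v.adicCompletion K)))]
    [IsAdicComplete (Ideal.span {(p : integerC (v.adicCompletion K))}) (integerC (v.adicCompletion K))]
    (hp : valuation (v.adicCompletion K) p < 1) [Algebra ℚ_[p] (v.adicCompletion K)] :
    GaloisRep.IsDeRham (bdRPeriodRingData (F := v.adicCompletion K) (p := p) hp)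
      (restrictedRationalTateRep W (v.adicCompletion K) p) := by
  refine isDeRham_restrictedRationalTateRep_of_isDeRham_baseChange_above W v v' hv' (fun hp' ↦ ?_) hp
  exact (isDeRham_restrictedRationalTateRep_iff_of_isIsogenous hp' hiso).2 (h1 hp')

/-- **Potentially de Rham ⇒ de Rham (isomorphic-model form).** `W/K` elliptic over a number field, `v ∣ p`, `K'/K` finite with a
place `v' ∣ v`, `C` an admissible change of variables over `K'`; if `V_p(C • (W ×_K K'))|_{Γ_{K'_{v'}}}` is de Rham, then
`V_pW|_{Γ_{K_v}}` is de Rham. (`C • W' ≅ W'` over `K'`: `isIsogenous_smul`.) This is the form in which a good model over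
`𝒪_{K'_{v'}}` obtained by rescaling with a uniformizer power of `K'` is fed to the descent.
[cite: BrinonConrad2009, Prop. 6.3.8] [cite: SilvermanAEC2009, III.3.1(b) and VII.5.4] -/
theorem isDeRham_restrictedRationalTateRep_of_isDeRham_smul_baseChange_above
    {K : Type} [Field K] [NumberField K] (W : WeierstrassCurve K) [W.IsElliptic] {p : ℕ} [Fact p.Prime]
    {K' : Type} [Field K'] [NumberField K'] [Algebra K K']
    (v : HeightOneSpectrum (𝓞 K)) (v' : HeightOneSpectrum (𝓞 K')) [v'.asIdeal.LiesOver v.asIdeal]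
    (hv' : (p : 𝓞 K') ∈ v'.asIdeal) (C : VariableChange K')
    (h1 : ∀ [CharZero (v'.adicCompletion K')] [Fact (¬ IsUnit (p : integerC (v'.adicCompletion K')))]
      [IsAdicComplete (Ideal.span {(p : integerC (v'.adicCompletion K'))}) (integerC (v'.adicCompletion K'))]
      (hp' : valuation (v'.adicCompletion K') p < 1) [Algebra ℚ_[p] (v'.adicCompletion K')],
      GaloisRep.IsDeRham (bdRPeriodRingData (F := v'.adicCompletion K') (p := p) hp')
        (restrictedRationalTateRep (C • W.baseChange K') (v'.adicCompletion K') p))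
    [CharZero (v.adicCompletion K)] [Fact (¬ IsUnit (p : integerC (v.adicCompletion K)))]
    [IsAdicComplete (Ideal.span {(p : integerC (v.adicCompletion K))}) (integerC (v.adicCompletion K))]
    (hp : valuation (v.adicCompletion K) p < 1) [Algebra ℚ_[p] (v.adicCompletion K)] :
    GaloisRep.IsDeRham (bdRPeriodRingData (F := v.adicCompletion K) (p := p) hp)
      (restrictedRationalTateRep W (v.adicCompletion K) p) :=
  isDeRham_restrictedRationalTateRep_of_isDeRham_isogenous_above W v v' hv' (C • W.baseChange K')
    (isIsogenous_smul (W.baseChange K') C) (fun hp' ↦ h1 hp') hp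

/-! ### Over `ℚ`: the place `v` above `p` -/

/-- **Over `ℚ` (isomorphic-model form): `V_pW|_{Γ_{ℚ_v}}` is de Rham at the place `v` of `ℚ` above `p` as soon as, for SOME number
field `K'`, SOME place `v'` of `K'` above `p` and SOME change of variables `C` over `K'`, `V_p(C • (W ×_ℚ K'))|_{Γ_{K'_{v'}}}` is de
Rham** — every place of `K'` above `p` lies over `v` (`natCast_mem_asIdeal_iff_eq_primesEquiv_symm`).
[cite: BrinonConrad2009, Prop. 6.3.8] [cite: SilvermanAEC2009, III.3.1(b) and VII.5.4] -/
theorem isDeRham_restrictedRationalTateRep_adicCompletion_rat_of_isDeRham_smul_baseChange_above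
    (W : WeierstrassCurve ℚ) [W.IsElliptic] {p : ℕ} [Fact p.Prime]
    {K' : Type} [Field K'] [NumberField K'] (v' : HeightOneSpectrum (𝓞 K')) (hv' : (p : 𝓞 K') ∈ v'.asIdeal)
    (C : VariableChange K')
    (h1 : ∀ [CharZero (v'.adicCompletion K')] [Fact (¬ IsUnit (p : integerC (v'.adicCompletion K')))]
      [IsAdicComplete (Ideal.span {(p : integerC (v'.adicCompletion K'))}) (integerC (v'.adicCompletion K'))]
      (hp' : valuation (v'.adicCompletion K') p < 1) [Algebra ℚ_[p] (v'.adicCompletion K')],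
      GaloisRep.IsDeRham (bdRPeriodRingData (F := v'.adicCompletion K') (p := p) hp')
        (restrictedRationalTateRep (C • W.baseChange K') (v'.adicCompletion K') p))
    (v : HeightOneSpectrum (𝓞 ℚ)) (hv : (p : 𝓞 ℚ) ∈ v.asIdeal)
    [CharZero (v.adicCompletion ℚ)] [Fact (¬ IsUnit (p : integerC (v.adicCompletion ℚ)))]
    [IsAdicComplete (Ideal.span {(p : integerC (v.adicCompletion ℚ))}) (integerC (v.adicCompletion ℚ))]
    (hp : valuation (v.adicCompletion ℚ) p < 1) [Algebra ℚ_[p] (v.adicCompletion ℚ)] :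
    GaloisRep.IsDeRham (bdRPeriodRingData (F := v.adicCompletion ℚ) (p := p) hp)
      (restrictedRationalTateRep W (v.adicCompletion ℚ) p) := by
  have hpr : (p : ℕ).Prime := Fact.out
  -- `v'` lies over `v`: both `v` and `v' ∩ ℤ` are the place `(p)` of `ℚ`
  haveI : v'.asIdeal.LiesOver (v'.under (𝓞 ℚ)).asIdeal := liesOver_under v'
  have hv₀ : (p : 𝓞 ℚ) ∈ (v'.under (𝓞 ℚ)).asIdeal := (natCast_mem_asIdeal_iff_of_liesOver (v'.under (𝓞 ℚ)) v' p).1 hv'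
  have hvw : v = v'.under (𝓞 ℚ) :=
    ((natCast_mem_asIdeal_iff_eq_primesEquiv_symm v hpr).1 hv).trans
      ((natCast_mem_asIdeal_iff_eq_primesEquiv_symm (v'.under (𝓞 ℚ)) hpr).1 hv₀).symm
  subst hvw
  have key := isDeRham_restrictedRationalTateRep_of_isDeRham_smul_baseChange_above W (v'.under (𝓞 ℚ)) v' hv' C
    (fun hp' ↦ h1 hp') hp
  -- `Algebra ℚ ℚ_v` is a subsingleton: the statement's instance is the one of `key`
  rw [show (DivisionRing.toRatAlgebra : Algebra ℚ ((v'.under (𝓞 ℚ)).adicCompletion ℚ)) =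
      HeightOneSpectrum.instAlgebraAdicCompletion (𝓞 ℚ) ℚ (v'.under (𝓞 ℚ)) from Subsingleton.elim _ _]
  exact key

/-- **Over `ℚ` (isogenous-model form).** [cite: BrinonConrad2009, Prop. 6.3.8] [cite: SilvermanAEC2009, III.7.4] -/
theorem isDeRham_restrictedRationalTateRep_adicCompletion_rat_of_isDeRham_isogenous_above
    (W : WeierstrassCurve ℚ) [W.IsElliptic] {p : ℕ} [Fact p.Prime]
    {K' : Type} [Field K'] [NumberField K'] (v' : HeightOneSpectrum (𝓞 K')) (hv' : (p : 𝓞 K') ∈ v'.asIdeal)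
    (W₀ : WeierstrassCurve K') [W₀.IsElliptic] (hiso : IsIsogenous (W.baseChange K') W₀)
    (h1 : ∀ [CharZero (v'.adicCompletion K')] [Fact (¬ IsUnit (p : integerC (v'.adicCompletion K')))]
      [IsAdicComplete (Ideal.span {(p : integerC (v'.adicCompletion K'))}) (integerC (v'.adicCompletion K'))]
      (hp' : valuation (v'.adicCompletion K') p < 1) [Algebra ℚ_[p] (v'.adicCompletion K')],
      GaloisRep.IsDeRham (bdRPeriodRingData (F := v'.adicCompletion K') (p := p) hp')
        (restrictedRationalTateRep W₀ (v'.adicCompletion K') p))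
    (v : HeightOneSpectrum (𝓞 ℚ)) (hv : (p : 𝓞 ℚ) ∈ v.asIdeal)
    [CharZero (v.adicCompletion ℚ)] [Fact (¬ IsUnit (p : integerC (v.adicCompletion ℚ)))]
    [IsAdicComplete (Ideal.span {(p : integerC (v.adicCompletion ℚ))}) (integerC (v.adicCompletion ℚ))]
    (hp : valuation (v.adicCompletion ℚ) p < 1) [Algebra ℚ_[p] (v.adicCompletion ℚ)] :
    GaloisRep.IsDeRham (bdRPeriodRingData (F := v.adicCompletion ℚ) (p := p) hp)
      (restrictedRationalTateRep W (v.adicCompletion ℚ) p) := by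
  have hpr : (p : ℕ).Prime := Fact.out
  haveI : v'.asIdeal.LiesOver (v'.under (𝓞 ℚ)).asIdeal := liesOver_under v'
  have hv₀ : (p : 𝓞 ℚ) ∈ (v'.under (𝓞 ℚ)).asIdeal := (natCast_mem_asIdeal_iff_of_liesOver (v'.under (𝓞 ℚ)) v' p).1 hv'
  have hvw : v = v'.under (𝓞 ℚ) :=
    ((natCast_mem_asIdeal_iff_eq_primesEquiv_symm v hpr).1 hv).trans
      ((natCast_mem_asIdeal_iff_eq_primesEquiv_symm (v'.under (𝓞 ℚ)) hpr).1 hv₀).symm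
  subst hvw
  have key := isDeRham_restrictedRationalTateRep_of_isDeRham_isogenous_above W (v'.under (𝓞 ℚ)) v' hv' W₀ hiso
    (fun hp' ↦ h1 hp') hp
  rw [show (DivisionRing.toRatAlgebra : Algebra ℚ ((v'.under (𝓞 ℚ)).adicCompletion ℚ)) =
      HeightOneSpectrum.instAlgebraAdicCompletion (𝓞 ℚ) ℚ (v'.under (𝓞 ℚ)) from Subsingleton.elim _ _]
  exact key

end Literature.NumberTheory.PAdicHodge

end
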